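import Mathlib
import HarnessLib
import Literature.MathematicalPhysics.StatisticalMechanics.NextHamiltonianBounds
import Literature.MathematicalPhysics.StatisticalMechanics.LinearisedMap
import Literature.MathematicalPhysics.StatisticalMechanics.FluctuationPolymer
import Literature.MathematicalPhysics.StatisticalMechanics.FluctuationSmooth
import Literature.MathematicalPhysics.StatisticalMechanics.RenormalisationMapP2Fluct
import Literature.MathematicalPhysics.StatisticalMechanics.StrongNormExpDifferenceProduct

/-!
# The one-block term `G(B) = R_{k+1}K(B) + (B_kK)(B)` of the renormalisation map in the slot norm
# `|·|_{T_k^{B*}, w_{k:k+1}^B}`: size, Lipschitz bound, regularity ([ABKM19] Ch. 10.1, Lemma 10.6)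

In `GradientRG.nextKStep_sub_opC_eq` (RenormalisationMapRemainder) the single `k`-blocks `B ⊆ U`
contribute `(p_B − 1)·blockTerm(B) + p_B·Φ_B`, `blockTerm D K B = R_{k+1}K(B) + (B_kK)(B)`
(`LinearisedMap.blockTerm`; `B_kK = opB D K = −Π₂R_{k+1}K(B₀)`).  The `(p_B − 1)`-terms are handled by the
slot lemma `RenormalisationMapPMinusOneSlot.tayNormLE_subsum_pMinusOne_sub_abkm_slot`, which needs the
slot `G = blockTerm D K` bounded, Lipschitz, `C^{r₀}` and local in `|·|_{T_k^{B*}, w_{k:k+1}^B}`.  This file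
supplies exactly that for the torus data (`D.𝒞 = 𝒞_{k+1}`, reference block `B_{x₀}`, base point the
corner of `B_{x₀}*`), on any block `B = B_x`:

* **`tayNormLE_blockTerm_abkm`** — `|blockTerm(B)| ≤ (1 + 8C_{8.7})·C A_𝒫 A^{−1}` for `‖K‖_k^{(A)} ≤ C`
  (Lemma 8.4 for `R_{k+1}K(B)`: `A_𝒫·C A^{−1}`; Lemma 8.9 in the strong norm for `(B_kK)(B)`:
  `8‖B_kK‖_{k,0} ≤ 8C_{8.7}A_𝒫A^{−1}C` by Lemma 10.6);
* **`blockTerm_sub_abkm`**, **`tayNormLE_blockTerm_sub_abkm`** — `blockTerm D K B − blockTerm D K' B =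
  blockTerm D (K−K') B` and the Lipschitz bound `(1 + 8C_{8.7})·C_Δ A_𝒫 A^{−1}`;
* **`contDiff_blockTerm_abkm`**, **`isGaugeLocal_blockTerm_abkm`**.

Everything is proved; no named fact.

## References
* S. Adams, S. Buchholz, R. Kotecký, S. Müller, arXiv:1910.13564, Ch. 10.1 ((10.3)–(10.4)), Lemma 10.6,
  Lemma 8.4, Lemma 8.9 [AdamsBuchholzKoteckyMuller2019].
-/

noncomputable section

namespace Literature.MathematicalPhysics.StatisticalMechanics.GradientRG

open scoped BigOperators Classical
open Finset MeasureTheory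
open Literature.MathematicalPhysics.QuantumFieldTheory
open Literature.MathematicalPhysics.StatisticalMechanics.TorusPolymer
  (IsPolymer blockOf thicken boxCorner isPolymer_blockOf card_blockOf subset_thicken blocks_blockOf
    card_blocks_eq_numBlocks numBlocks)
open Literature.Barriers.CriticalPhenomena.LongRangePhi4.Polymer (IsConn)

variable {d M : ℕ} [NeZero M]

/-- **`blockTerm` is local for `T_k^{B*}`** on a block `B = B_x` (`K(B,·)` local).
[cite: AdamsBuchholzKoteckyMuller2019, Ch. 10.1 (10.4) / Lemma 6.4 (2)] -/
theorem isGaugeLocal_blockTerm_abkm {L N Mord R p r₀ : ℕ} {θbar h A : ℝ} {δ' : ℕ → ℝ}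
    {𝒞 : ℕ → (Fin d → ZMod M) → ℝ} (hLodd : Odd L) (hh : 0 < h) (hp : d / 2 + 1 ≤ p) (k : ℕ)
    (D : StepData d M) (x : Fin d → ZMod M) {K : Finset (Fin d → ZMod M) → ((Fin d → ZMod M) → ℝ) → ℂ}
    (hKloc : IsGaugeLocal ((abkmNormParams L N Mord R p r₀ h θbar A δ' 𝒞).gauge k (blockOf (L ^ k) x))
      (K (blockOf (L ^ k) x))) :
    IsGaugeLocal ((abkmNormParams L N Mord R p r₀ h θbar A δ' 𝒞).gauge k (blockOf (L ^ k) x))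
      (blockTerm D K (blockOf (L ^ k) x)) := by
  set P := abkmNormParams L N Mord R p r₀ h θbar A δ' 𝒞 with hP
  set B := blockOf (L ^ k) x with hBdef
  have hL0 : (0 : ℝ) < L := by exact_mod_cast hLodd.pos
  have h𝔥 : 0 < fieldWt h (L : ℝ) d k := fieldWt_pos hh hL0 d k
  have hRk : (0 : ℝ) < (L : ℝ) ^ k := by positivity
  have hBS : B ⊆ thicken (P.rad k) B := subset_thicken _ _
  have hgauge : P.gauge k B = fieldGauge (fieldWt h (L : ℝ) d k) ((L : ℝ) ^ k) p (thicken (P.rad k) B) := rfl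
  have hev : IsGaugeLocal (P.gauge k B) (fun φ : (Fin d → ZMod M) → ℝ => eval (opB D K) B φ) := by
    rw [hgauge]; exact isGaugeLocal_eval h𝔥.ne' hRk.ne' hp hBS _
  have hfl : IsGaugeLocal (P.gauge k B) (fluct D.𝒞 (K B)) := isGaugeLocal_fluct _ _ hKloc
  intro φ ψ hT
  have e := hev φ ψ hT
  simp only at e
  show fluct D.𝒞 (K B) φ + eval (opB D K) B φ = fluct D.𝒞 (K B) ψ + eval (opB D K) B ψ
  rw [hfl φ ψ hT, e]

/-- **`blockTerm` is `C^{r₀}`** for the torus data and `‖K‖_k^{(A)} ≤ C` (`A > 0`).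
[cite: AdamsBuchholzKoteckyMuller2019, Ch. 10.1 (10.4) / Lemma 8.4] -/
theorem contDiff_blockTerm_abkm {L N Mord R n p r₀ : ℕ} {θbar lam μ δ₁ δ₀ A𝒫 h A : ℝ}
    {𝒞 : ℕ → (Fin d → ZMod M) → ℝ} (hθbar : 0 < θbar) (hlam : 0 < lam)
    (hB : AbkmWeightBounds L N Mord R n θbar lam μ δ₁ δ₀ A𝒫 𝒞
      (abkmWeightData L N Mord R θbar (schedDelta δ₀ δ₁ N) 𝒞))
    (hLodd : Odd L) (hM : M = L ^ N) {k : ℕ} (hk : k + 1 ≤ N + 1) (hA : 0 < A)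
    (D : StepData d M) (hD𝒞 : D.𝒞 = 𝒞 (k + 1)) (x : Fin d → ZMod M)
    {K : Finset (Fin d → ZMod M) → ((Fin d → ZMod M) → ℝ) → ℂ} {C : ℝ} (hC : 0 ≤ C)
    (hK : WeakNormLE (abkmNormParams L N Mord R p r₀ h θbar A (schedDelta δ₀ δ₁ N) 𝒞) k K C)
    (hKd : ∀ X, ContDiff ℝ r₀ (K X))
    (hKloc : ∀ X, IsPolymer (L ^ k) X → IsConn X →
      IsGaugeLocal ((abkmNormParams L N Mord R p r₀ h θbar A (schedDelta δ₀ δ₁ N) 𝒞).gauge k X) (K X)) :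
    ContDiff ℝ r₀ (blockTerm D K (blockOf (L ^ k) x)) := by
  have hMo : Odd M := by rw [hM]; exact hLodd.pow
  have h1 : ContDiff ℝ r₀ (fluct D.𝒞 (K (blockOf (L ^ k) x))) := by
    rw [hD𝒞]
    exact contDiff_fluct_of_weakNormLE hθbar hlam hB hk hA hC hK hKd hKloc (isPolymer_blockOf _ x)
      (TorusPolymer.isConn_blockOf hMo hLodd.pow x)
  show ContDiff ℝ r₀ (fun φ => fluct D.𝒞 (K (blockOf (L ^ k) x)) φ + eval (opB D K) (blockOf (L ^ k) x) φ)
  exact h1.add (contDiff_eval _ _)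

/-- **`blockTerm` is additive in `K`** (difference form, torus data; `R_{k+1}` and `B_k` are additive
on activities with finite weak norm): `blockTerm D K B − blockTerm D K' B = blockTerm D (K − K') B`.
[cite: AdamsBuchholzKoteckyMuller2019, Theorem 6.8 (C_k is linear)] -/
theorem blockTerm_sub_abkm {L N Mord R n p r₀ : ℕ} {θbar lam μ δ₁ δ₀ A𝒫 h A : ℝ}
    {𝒞 : ℕ → (Fin d → ZMod M) → ℝ} (hθbar : 0 < θbar) (hlam : 0 < lam)
    (hB : AbkmWeightBounds L N Mord R n θbar lam μ δ₁ δ₀ A𝒫 𝒞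
      (abkmWeightData L N Mord R θbar (schedDelta δ₀ δ₁ N) 𝒞))
    {k : ℕ} (hk : k + 1 ≤ N + 1) (hr₀ : 2 ≤ r₀) (hLodd : Odd L) (hM : M = L ^ N) (hA : 0 < A)
    (D : StepData d M) (hD𝒞 : D.𝒞 = 𝒞 (k + 1)) {x₀ : Fin d → ZMod M} (hB₀ : D.B₀ = blockOf (L ^ k) x₀)
    (x : Fin d → ZMod M)
    {K K' : Finset (Fin d → ZMod M) → ((Fin d → ZMod M) → ℝ) → ℂ} {C C' : ℝ} (hC : 0 ≤ C) (hC' : 0 ≤ C')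
    (hK : WeakNormLE (abkmNormParams L N Mord R p r₀ h θbar A (schedDelta δ₀ δ₁ N) 𝒞) k K C)
    (hK' : WeakNormLE (abkmNormParams L N Mord R p r₀ h θbar A (schedDelta δ₀ δ₁ N) 𝒞) k K' C')
    (hKd : ∀ X, ContDiff ℝ r₀ (K X)) (hK'd : ∀ X, ContDiff ℝ r₀ (K' X))
    (hKloc : ∀ X, IsPolymer (L ^ k) X → IsConn X →
      IsGaugeLocal ((abkmNormParams L N Mord R p r₀ h θbar A (schedDelta δ₀ δ₁ N) 𝒞).gauge k X) (K X))
    (hK'loc : ∀ X, IsPolymer (L ^ k) X → IsConn X →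
      IsGaugeLocal ((abkmNormParams L N Mord R p r₀ h θbar A (schedDelta δ₀ δ₁ N) 𝒞).gauge k X) (K' X)) :
    (fun φ => blockTerm D K (blockOf (L ^ k) x) φ - blockTerm D K' (blockOf (L ^ k) x) φ) =
      blockTerm D (K - K') (blockOf (L ^ k) x) := by
  set P := abkmNormParams L N Mord R p r₀ h θbar A (schedDelta δ₀ δ₁ N) 𝒞 with hP
  set B := blockOf (L ^ k) x with hBdef
  have hMo : Odd M := by rw [hM]; exact hLodd.pow
  have hPB : IsPolymer (L ^ k) B := isPolymer_blockOf _ x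
  have hcB : IsConn B := TorusPolymer.isConn_blockOf hMo hLodd.pow x
  have hCn : 0 ≤ C * P.aFactor k B := mul_nonneg hC (WeakNormLE.aFactor_pos hA k _).le
  have hC'n : 0 ≤ C' * P.aFactor k B := mul_nonneg hC' (WeakNormLE.aFactor_pos hA k _).le
  have hdom := weightSectionDominated_abkm hθbar hlam hB hk B (P.gauge k B)
  have hiK : ∀ φ, Integrable (fun ξ => K B (φ + ξ)) (stepMeasure D.𝒞) := fun φ => by
    rw [hD𝒞]
    exact integrable_comp_add_of_tayNormLE (hK B hPB hcB) hCn (hKd _) (hKloc _ hPB hcB) hdom φ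
  have hiK' : ∀ φ, Integrable (fun ξ => K' B (φ + ξ)) (stepMeasure D.𝒞) := fun φ => by
    rw [hD𝒞]
    exact integrable_comp_add_of_tayNormLE (hK' B hPB hcB) hC'n (hK'd _) (hK'loc _ hPB hcB) hdom φ
  have hfl : fluct D.𝒞 (K B) - fluct D.𝒞 (K' B) = fluct D.𝒞 ((K - K') B) := by
    rw [show (K - K') B = K B - K' B from rfl]; exact (fluct_sub_of_integrable hiK hiK').symm
  have hop := opB_sub_abkm hθbar hlam hB hk hr₀ hLodd hM hA D hD𝒞 hB₀ hC hC' hK hK' hKd hK'd hKloc hK'loc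
  funext φ
  show fluct D.𝒞 (K B) φ + eval (opB D K) B φ - (fluct D.𝒞 (K' B) φ + eval (opB D K') B φ) =
    fluct D.𝒞 ((K - K') B) φ + eval (opB D (K - K')) B φ
  rw [← hop, eval_sub, ← hfl, Pi.sub_apply]
  ring

/-- **Size of `blockTerm` in the slot norm** ([ABKM19] Ch. 10.1 with Lemma 8.4, Lemma 8.9 (strong form)
and Lemma 10.6): torus data at scale `k` (`d ≥ 2`, `L` odd, `L ≥ 2^{d+3}+16R`, `M = L^N`, `k+1 ≤ N`,
`p ≤ R`, `⌊d/2⌋+1 ≤ min(p, M_ord)`, `r₀ ≥ 2`, `θ̄, λ, δ₀, δ₁ > 0`, `h² ≥ h₀²`, `A ≥ 1`, step data with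
`D.𝒞 = 𝒞_{k+1}`, reference block `B_{x₀}` and its box corner), `‖K‖_k^{(A)} ≤ C`, `C^{r₀}`, local: on any block
`B = B_x`, `|blockTerm D K B|_{T_k^{B*}, w_{k:k+1}^B} ≤ (1 + 8C_{8.7})·(C A_𝒫 A^{−1})`.
[cite: AdamsBuchholzKoteckyMuller2019, Ch. 10.1 (10.4) / Lemma 10.6] -/
theorem tayNormLE_blockTerm_abkm {L N Mord R n p r₀ : ℕ} {θbar lam μ δ₁ δ₀ A𝒫 h A : ℝ}
    {𝒞 : ℕ → (Fin d → ZMod M) → ℝ} (hd : 2 ≤ d) (hLodd : Odd L) (hL : 2 ^ (d + 3) + 16 * R ≤ L)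
    (hM : M = L ^ N) {k : ℕ} (hkN : k + 1 ≤ N) (hp : d / 2 + 1 ≤ p) (hpR : p ≤ R) (hMord : d / 2 + 1 ≤ Mord)
    (hr₀ : 2 ≤ r₀) (hθbar : 0 < θbar) (hlam : 0 < lam)
    (hB : AbkmWeightBounds L N Mord R n θbar lam μ δ₁ δ₀ A𝒫 𝒞
      (abkmWeightData L N Mord R θbar (schedDelta δ₀ δ₁ N) 𝒞))
    (hδ₀ : 0 < δ₀) (hδ₁ : 0 < δ₁) (hh : 0 < h) (hh0 : hZeroSq d R δ₀ δ₁ ≤ h ^ 2) (hA : 1 ≤ A)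
    (D : StepData d M) (hD𝒞 : D.𝒞 = 𝒞 (k + 1)) {x₀ : Fin d → ZMod M} (hB₀ : D.B₀ = blockOf (L ^ k) x₀)
    (hc₀ : D.c₀ = boxCorner (L ^ k) (starRad R L d k) x₀) (x : Fin d → ZMod M)
    {K : Finset (Fin d → ZMod M) → ((Fin d → ZMod M) → ℝ) → ℂ} {C : ℝ} (hC : 0 ≤ C)
    (hK : WeakNormLE (abkmNormParams L N Mord R p r₀ h θbar A (schedDelta δ₀ δ₁ N) 𝒞) k K C)
    (hKd : ∀ X, ContDiff ℝ r₀ (K X))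
    (hKloc : ∀ X, IsPolymer (L ^ k) X → IsConn X →
      IsGaugeLocal ((abkmNormParams L N Mord R p r₀ h θbar A (schedDelta δ₀ δ₁ N) 𝒞).gauge k X) (K X)) :
    TayNormLE ((abkmNormParams L N Mord R p r₀ h θbar A (schedDelta δ₀ δ₁ N) 𝒞).gauge k (blockOf (L ^ k) x))
      r₀ ((abkmWeightData L N Mord R θbar (schedDelta δ₀ δ₁ N) 𝒞).midWeight k (blockOf (L ^ k) x))
      (blockTerm D K (blockOf (L ^ k) x))
      ((1 + 8 * pi2BoundConst d (((2 * R + 2 : ℕ) : ℝ) + ((d / 2 + 1 : ℕ) : ℝ))) * (C * A𝒫 * A⁻¹)) := by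
  set P := abkmNormParams L N Mord R p r₀ h θbar A (schedDelta δ₀ δ₁ N) 𝒞 with hP
  set W := abkmWeightData L N Mord R θbar (schedDelta δ₀ δ₁ N) 𝒞 with hW
  set B := blockOf (L ^ k) x with hBdef
  set C87 := pi2BoundConst d (((2 * R + 2 : ℕ) : ℝ) + ((d / 2 + 1 : ℕ) : ℝ)) with hC87
  have hL0 : (0 : ℝ) < L := by exact_mod_cast hLodd.pos
  have hA0 : 0 < A := by linarith
  have hk' : k + 1 ≤ N + 1 := by omega
  have hk : k ≤ N := by omega
  obtain ⟨t, ht⟩ : ∃ t, N = k + t := ⟨N - k, by omega⟩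
  have hMt : M = L ^ k * L ^ t := by rw [← pow_add, ← ht]; exact hM
  have hMo : Odd M := by rw [hM]; exact hLodd.pow
  have hcard : B.card = L ^ (d * k) := by
    rw [hBdef, card_blockOf hMt hLodd.pow hLodd.pow x, ← pow_mul, mul_comm]
  have h𝔥 : 0 < fieldWt h (L : ℝ) d k := fieldWt_pos hh hL0 d k
  have hRk : (0 : ℝ) < (L : ℝ) ^ k := by positivity
  have hBS : B ⊆ thicken (P.rad k) B := subset_thicken _ _
  have hgauge : P.gauge k B = fieldGauge (fieldWt h (L : ℝ) d k) ((L : ℝ) ^ k) p (thicken (P.rad k) B) := rfl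
  have hPB : IsPolymer (L ^ k) B := isPolymer_blockOf _ x
  have hcB : IsConn B := TorusPolymer.isConn_blockOf hMo hLodd.pow x
  have hnB : numBlocks (L ^ k) B = 1 := by
    rw [← card_blocks_eq_numBlocks, hBdef, blocks_blockOf, card_singleton]
  have haF : P.aFactor k B = A⁻¹ := by
    show (A ^ numBlocks (L ^ k) B)⁻¹ = A⁻¹; rw [hnB, pow_one]
  have hC87_0 : 0 ≤ C87 := pi2BoundConst_nonneg d (by positivity)
  -- (i) `R_{k+1}K(B)`
  have hKB : TayNormLE (P.gauge k B) r₀ (W.weight k B) (K B) (C * A⁻¹) := by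
    have h1 := hK B hPB hcB; rw [haF] at h1; exact h1
  have hc1 : 0 ≤ C * A⁻¹ := by positivity
  have hR : TayNormLE (P.gauge k B) r₀ (W.midWeight k B) (fluct D.𝒞 (K B)) (C * A⁻¹ * A𝒫) := by
    have h1 := tayNormLE_fluct_abkm hθbar hlam hB hk' hPB (P.gauge k B) hc1 (hKd B) (hKloc B hPB hcB) hKB
    rw [hnB, pow_one, ← hD𝒞] at h1
    exact h1
  have hRd : ContDiff ℝ r₀ (fluct D.𝒞 (K B)) := by
    rw [hD𝒞]; exact contDiff_fluct_of_weakNormLE hθbar hlam hB hk' hA0 hC hK hKd hKloc hPB hcB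
  -- (ii) `(B_kK)(B)` in the strong norm
  have hSW : ∀ φ, expWeight (strongCoef h N k • derivForm (L : ℝ) k (diffIndex d Mord)
      (boxDensity (boxRad R L k) (boxWt (L : ℝ) d k) B)) φ ≤ W.weight k B φ :=
    fun φ => strongWeight_le_weight_abkm hB hδ₀ hδ₁ hh hh0 k (subset_refl B) φ
  have hwm : ∀ φ, W.weight k B φ ≤ W.midWeight k B φ := fun φ =>
    WeightData.weight_le_midWeight hB.dominated k B φ
  have hev_s := tayNormLE_eval_strong_abkm (R := R) (Mord := Mord) hd hLodd hM hk hh hMord hp hBS (opB D K) r₀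
  rw [← hgauge, hcard] at hev_s
  have hopB := hamNorm_opB_abkm_le_scale hLodd hL hM hkN hpR hr₀ hθbar hlam hB hh hA D hD𝒞 hB₀ hc₀ hC hK hKd
    hKloc
  have hn0 : 0 ≤ hamNorm (fieldWt h (L : ℝ) d k) ((L : ℝ) ^ k) (L ^ (d * k)) (opB D K) :=
    hamNorm_nonneg h𝔥.le hRk.le _ _
  have hc2 : 0 ≤ 8 * hamNorm (fieldWt h (L : ℝ) d k) ((L : ℝ) ^ k) (L ^ (d * k)) (opB D K) := by positivity
  have hE : TayNormLE (P.gauge k B) r₀ (W.midWeight k B) (fun φ : (Fin d → ZMod M) → ℝ => eval (opB D K) B φ)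
      (8 * (C87 * (C * A𝒫 * A⁻¹))) :=
    (((hev_s.mono_weight hc2 hSW).mono_weight hc2 hwm).mono (by nlinarith) fun φ => (W.midWeight_pos k B φ).le)
  -- combine
  have heq : blockTerm D K B = fluct D.𝒞 (K B) + fun φ : (Fin d → ZMod M) → ℝ => eval (opB D K) B φ := by
    funext φ; rfl
  rw [heq]
  refine ((hR.add hE hRd (contDiff_eval _ _)).mono ?_ fun φ => (W.midWeight_pos k B φ).le)
  ring_nf
  rfl

/-- **Lipschitz bound of `blockTerm` in the slot norm**: with the data of `tayNormLE_blockTerm_abkm` for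
`K` and `K'` (`‖K‖, ‖K'‖ ≤ C`) and `‖K − K'‖_k^{(A)} ≤ C_Δ`:
`|blockTerm D K B − blockTerm D K' B|_{T_k^{B*}, w_{k:k+1}^B} ≤ (1 + 8C_{8.7})·(C_Δ A_𝒫 A^{−1})`.
[cite: AdamsBuchholzKoteckyMuller2019, Ch. 10.1 (10.4) / Lemma 10.6] -/
theorem tayNormLE_blockTerm_sub_abkm {L N Mord R n p r₀ : ℕ} {θbar lam μ δ₁ δ₀ A𝒫 h A : ℝ}
    {𝒞 : ℕ → (Fin d → ZMod M) → ℝ} (hd : 2 ≤ d) (hLodd : Odd L) (hL : 2 ^ (d + 3) + 16 * R ≤ L)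
    (hM : M = L ^ N) {k : ℕ} (hkN : k + 1 ≤ N) (hp : d / 2 + 1 ≤ p) (hpR : p ≤ R) (hMord : d / 2 + 1 ≤ Mord)
    (hr₀ : 2 ≤ r₀) (hθbar : 0 < θbar) (hlam : 0 < lam)
    (hB : AbkmWeightBounds L N Mord R n θbar lam μ δ₁ δ₀ A𝒫 𝒞
      (abkmWeightData L N Mord R θbar (schedDelta δ₀ δ₁ N) 𝒞))
    (hδ₀ : 0 < δ₀) (hδ₁ : 0 < δ₁) (hh : 0 < h) (hh0 : hZeroSq d R δ₀ δ₁ ≤ h ^ 2) (hA : 1 ≤ A)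
    (D : StepData d M) (hD𝒞 : D.𝒞 = 𝒞 (k + 1)) {x₀ : Fin d → ZMod M} (hB₀ : D.B₀ = blockOf (L ^ k) x₀)
    (hc₀ : D.c₀ = boxCorner (L ^ k) (starRad R L d k) x₀) (x : Fin d → ZMod M)
    {K K' : Finset (Fin d → ZMod M) → ((Fin d → ZMod M) → ℝ) → ℂ} {C CΔ : ℝ} (hC : 0 ≤ C) (hCΔ : 0 ≤ CΔ)
    (hK : WeakNormLE (abkmNormParams L N Mord R p r₀ h θbar A (schedDelta δ₀ δ₁ N) 𝒞) k K C)
    (hK' : WeakNormLE (abkmNormParams L N Mord R p r₀ h θbar A (schedDelta δ₀ δ₁ N) 𝒞) k K' C)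
    (hΔ : WeakNormLE (abkmNormParams L N Mord R p r₀ h θbar A (schedDelta δ₀ δ₁ N) 𝒞) k (K - K') CΔ)
    (hKd : ∀ X, ContDiff ℝ r₀ (K X)) (hK'd : ∀ X, ContDiff ℝ r₀ (K' X))
    (hKloc : ∀ X, IsPolymer (L ^ k) X → IsConn X →
      IsGaugeLocal ((abkmNormParams L N Mord R p r₀ h θbar A (schedDelta δ₀ δ₁ N) 𝒞).gauge k X) (K X))
    (hK'loc : ∀ X, IsPolymer (L ^ k) X → IsConn X →
      IsGaugeLocal ((abkmNormParams L N Mord R p r₀ h θbar A (schedDelta δ₀ δ₁ N) 𝒞).gauge k X) (K' X)) :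
    TayNormLE ((abkmNormParams L N Mord R p r₀ h θbar A (schedDelta δ₀ δ₁ N) 𝒞).gauge k (blockOf (L ^ k) x))
      r₀ ((abkmWeightData L N Mord R θbar (schedDelta δ₀ δ₁ N) 𝒞).midWeight k (blockOf (L ^ k) x))
      (fun φ => blockTerm D K (blockOf (L ^ k) x) φ - blockTerm D K' (blockOf (L ^ k) x) φ)
      ((1 + 8 * pi2BoundConst d (((2 * R + 2 : ℕ) : ℝ) + ((d / 2 + 1 : ℕ) : ℝ))) * (CΔ * A𝒫 * A⁻¹)) := by
  have hA0 : 0 < A := by linarith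
  have hk' : k + 1 ≤ N + 1 := by omega
  have hKΔd : ∀ X, ContDiff ℝ r₀ ((K - K') X) := fun X => by
    show ContDiff ℝ r₀ (K X - K' X); exact (hKd X).sub (hK'd X)
  have hKΔloc : ∀ X, IsPolymer (L ^ k) X → IsConn X →
      IsGaugeLocal ((abkmNormParams L N Mord R p r₀ h θbar A (schedDelta δ₀ δ₁ N) 𝒞).gauge k X) ((K - K') X) :=
    fun X hX hc φ ψ e => by
      show (K X - K' X) φ = (K X - K' X) ψ
      simp only [Pi.sub_apply]
      rw [hKloc X hX hc φ ψ e, hK'loc X hX hc φ ψ e]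
  rw [blockTerm_sub_abkm hθbar hlam hB hk' hr₀ hLodd hM hA0 D hD𝒞 hB₀ x hC hC hK hK' hKd hK'd hKloc hK'loc]
  exact tayNormLE_blockTerm_abkm hd hLodd hL hM hkN hp hpR hMord hr₀ hθbar hlam hB hδ₀ hδ₁ hh hh0 hA D hD𝒞
    hB₀ hc₀ x hCΔ hΔ hKΔd hKΔloc

end Literature.MathematicalPhysics.StatisticalMechanics.GradientRG

end
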